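import Summits.ValiantsHypothesis.ValiantsHypothesis.Theorems.LacunarySymmetroidMatrixDescartesCensusDoorA34NodeForm

/-!
# `MatrixDescartes` census — DOOR A at `(3,4)`: the node frame reduces the determinant to ONE SCALAR polynomial
# `∑ᵢ Cᵢ² ∏_{j≠i} Lⱼ(X)` — `DoorA34` implies the scalar `e₃`-bound

HONEST FRAMING.  Object-search cell `pub-symmetroid`, door-A seat `val-sym-door-p3` (g9); item stmt-ValiantsHypothesis-19980
`DoorA34 = PosRootLawAt 3 4 18` (route item `Theses.LacunarySymmetroid.DoorA34`, `doorA34_iff`) is OPEN and asserted nowhere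
in this file.  `…CensusDoorA34NodeForm` proves the node form of the determinant VALUE-WISE (`eval_det_pencil_rankOneLetters`,
`det_sum_four_rankOne`).  Here the same is recorded at the level of POLYNOMIALS, so that root multisets — and the door's count of
distinct positive roots — transfer verbatim:

* `eval_nodePoly` — the node `K`-nomial `Lᵢ = ∑ₗ C (A i l) · X^(d l)` evaluates to `ℓᵢ(t) = ∑ₗ A i l · t^(d l)`;
* **`det_pencil_rankOneLetters_eq_nodePoly`** — for letters `S l = ∑ᵢ A i l • vᵢvᵢᵀ` (ANY support `d`, any `K`),
  `det (∑ₗ X^(d l) • S l) = ∑ᵢ C(Cᵢ²) · ∏_{j ≠ i} Lⱼ` in `ℝ[X]` (`Polynomial.funext` over the value-wise identity), hence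
  `roots_det_pencil_rankOneLetters` / `card_posRoots_det_pencil_rankOneLetters`: same roots, same positive-root count;
* **`card_posRoots_nodePoly_le_of_doorA34`** — `DoorA34` IMPLIES the scalar bound: for every support `d : Fin 4 → ℕ`, every
  coefficient matrix `A` and every four vectors `vᵢ ∈ ℝ³`, the scalar polynomial `∑ᵢ Cᵢ² ∏_{j≠i} Lⱼ` has at most `18` distinct
  positive roots (node-form letters are symmetric: `isSymm_rankOneLetter`);
* `doorA34_nodeForm_iff_scalar` — restricted to node-form nets, the door IS the scalar statement (an `Iff` of two explicit `∀`).

The CONVERSE «scalar bound ⇒ DoorA34» is NOT proved here: it needs (i) that a generic real symmetric `(3,4)` net is spanned by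
four rank-one members, real or complex-conjugate (classes R4/R2/R0 — only R4 is the statement above), and (ii) a closure /
perturbation argument for the non-generic nets.  Nothing here bounds `ζ_sym(3,4)`; `DoorA34` stays OPEN; nothing bears on
`MatrixDescartes` (stmt-ValiantsHypothesis-18050) or on `VP ≠ VNP`.  [folklore] Elementary.
-/

-- `Summit.ValiantsHypothesis.ValiantsHypothesis.…` repeats a component by the D-0017 layout
-- (single-conjunct summit), which the `dupNamespace` linter flags; the name is mandated.
set_option linter.dupNamespace false

namespace Summit.ValiantsHypothesis.ValiantsHypothesis.Theorems.LacunarySymmetroidMatrixDescartes.Census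

open Polynomial Finset
open scoped BigOperators Polynomial Matrix
open Summit.ValiantsHypothesis.ValiantsHypothesis.Theorems.MatrixDescartes.Negative (PosRootLawAt)

/-- The node `K`-nomial `Lᵢ = ∑ₗ C aₗ · X^(d l)` evaluates to `∑ₗ aₗ t^(d l)`. [folklore] -/
theorem eval_nodePoly {K : ℕ} (d : Fin K → ℕ) (a : Fin K → ℝ) (t : ℝ) :
    (∑ l, C (a l) * (X : ℝ[X]) ^ d l).eval t = ∑ l, a l * t ^ d l := by
  rw [eval_finsetSum]
  refine Finset.sum_congr rfl fun l _ => ?_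
  rw [eval_mul, eval_C, eval_pow, eval_X]

/-- **Node form of the determinant, as a POLYNOMIAL identity.**  For letters `S l = ∑ᵢ A i l • vᵢvᵢᵀ` on any support `d`,
`det (∑ₗ X^(d l) • S l) = ∑ᵢ C(Cᵢ²) · ∏_{j≠i} Lⱼ` in `ℝ[X]`, `Lⱼ = ∑ₗ C (A j l) X^(d l)`, `Cᵢ` the cofactor determinants of
`det_sum_four_rankOne`. [folklore] -/
theorem det_pencil_rankOneLetters_eq_nodePoly {K : ℕ} (d : Fin K → ℕ) (A : Fin 4 → Fin K → ℝ) (v : Fin 4 → Fin 3 → ℝ) :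
    (∑ l, (X : ℝ[X]) ^ d l • (∑ i, A i l • Matrix.vecMulVec (v i) (v i)).map C).det =
      C ((v 1 0 * (v 2 1 * v 3 2 - v 3 1 * v 2 2) - v 2 0 * (v 1 1 * v 3 2 - v 3 1 * v 1 2)
          + v 3 0 * (v 1 1 * v 2 2 - v 2 1 * v 1 2)) ^ 2) *
          ((∑ l, C (A 1 l) * (X : ℝ[X]) ^ d l) * (∑ l, C (A 2 l) * (X : ℝ[X]) ^ d l) * (∑ l, C (A 3 l) * (X : ℝ[X]) ^ d l))
      + C ((v 0 0 * (v 2 1 * v 3 2 - v 3 1 * v 2 2) - v 2 0 * (v 0 1 * v 3 2 - v 3 1 * v 0 2)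
          + v 3 0 * (v 0 1 * v 2 2 - v 2 1 * v 0 2)) ^ 2) *
          ((∑ l, C (A 0 l) * (X : ℝ[X]) ^ d l) * (∑ l, C (A 2 l) * (X : ℝ[X]) ^ d l) * (∑ l, C (A 3 l) * (X : ℝ[X]) ^ d l))
      + C ((v 0 0 * (v 1 1 * v 3 2 - v 3 1 * v 1 2) - v 1 0 * (v 0 1 * v 3 2 - v 3 1 * v 0 2)
          + v 3 0 * (v 0 1 * v 1 2 - v 1 1 * v 0 2)) ^ 2) *
          ((∑ l, C (A 0 l) * (X : ℝ[X]) ^ d l) * (∑ l, C (A 1 l) * (X : ℝ[X]) ^ d l) * (∑ l, C (A 3 l) * (X : ℝ[X]) ^ d l))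
      + C ((v 0 0 * (v 1 1 * v 2 2 - v 2 1 * v 1 2) - v 1 0 * (v 0 1 * v 2 2 - v 2 1 * v 0 2)
          + v 2 0 * (v 0 1 * v 1 2 - v 1 1 * v 0 2)) ^ 2) *
          ((∑ l, C (A 0 l) * (X : ℝ[X]) ^ d l) * (∑ l, C (A 1 l) * (X : ℝ[X]) ^ d l) * (∑ l, C (A 2 l) * (X : ℝ[X]) ^ d l)) := by
  apply Polynomial.funext
  intro t
  rw [eval_det_pencil_rankOneLetters, det_sum_four_rankOne]
  simp only [eval_add, eval_mul, eval_C, eval_nodePoly]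

/-- Hence the det-root multiset of a node-form pencil IS the root multiset of the scalar polynomial `∑ᵢ C(Cᵢ²) ∏_{j≠i} Lⱼ`.
[folklore] -/
theorem roots_det_pencil_rankOneLetters {K : ℕ} (d : Fin K → ℕ) (A : Fin 4 → Fin K → ℝ) (v : Fin 4 → Fin 3 → ℝ) :
    (∑ l, (X : ℝ[X]) ^ d l • (∑ i, A i l • Matrix.vecMulVec (v i) (v i)).map C).det.roots =
      (C ((v 1 0 * (v 2 1 * v 3 2 - v 3 1 * v 2 2) - v 2 0 * (v 1 1 * v 3 2 - v 3 1 * v 1 2)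
          + v 3 0 * (v 1 1 * v 2 2 - v 2 1 * v 1 2)) ^ 2) *
          ((∑ l, C (A 1 l) * (X : ℝ[X]) ^ d l) * (∑ l, C (A 2 l) * (X : ℝ[X]) ^ d l) * (∑ l, C (A 3 l) * (X : ℝ[X]) ^ d l))
      + C ((v 0 0 * (v 2 1 * v 3 2 - v 3 1 * v 2 2) - v 2 0 * (v 0 1 * v 3 2 - v 3 1 * v 0 2)
          + v 3 0 * (v 0 1 * v 2 2 - v 2 1 * v 0 2)) ^ 2) *
          ((∑ l, C (A 0 l) * (X : ℝ[X]) ^ d l) * (∑ l, C (A 2 l) * (X : ℝ[X]) ^ d l) * (∑ l, C (A 3 l) * (X : ℝ[X]) ^ d l))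
      + C ((v 0 0 * (v 1 1 * v 3 2 - v 3 1 * v 1 2) - v 1 0 * (v 0 1 * v 3 2 - v 3 1 * v 0 2)
          + v 3 0 * (v 0 1 * v 1 2 - v 1 1 * v 0 2)) ^ 2) *
          ((∑ l, C (A 0 l) * (X : ℝ[X]) ^ d l) * (∑ l, C (A 1 l) * (X : ℝ[X]) ^ d l) * (∑ l, C (A 3 l) * (X : ℝ[X]) ^ d l))
      + C ((v 0 0 * (v 1 1 * v 2 2 - v 2 1 * v 1 2) - v 1 0 * (v 0 1 * v 2 2 - v 2 1 * v 0 2)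
          + v 2 0 * (v 0 1 * v 1 2 - v 1 1 * v 0 2)) ^ 2) *
          ((∑ l, C (A 0 l) * (X : ℝ[X]) ^ d l) * (∑ l, C (A 1 l) * (X : ℝ[X]) ^ d l) * (∑ l, C (A 2 l) * (X : ℝ[X]) ^ d l))).roots := by
  rw [det_pencil_rankOneLetters_eq_nodePoly]

/-- Node-form letters `∑ᵢ A i l • vᵢvᵢᵀ` are symmetric. [folklore] -/
theorem isSymm_rankOneLetter {K : ℕ} (A : Fin 4 → Fin K → ℝ) (v : Fin 4 → Fin 3 → ℝ) (l : Fin K) :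
    (∑ i, A i l • Matrix.vecMulVec (v i) (v i)).IsSymm := by
  refine Matrix.IsSymm.ext fun a b => ?_
  simp only [Matrix.sum_apply, Matrix.smul_apply, Matrix.vecMulVec_apply, smul_eq_mul]
  exact Finset.sum_congr rfl fun i _ => by ring

/-- **`DoorA34` implies the scalar `e₃`-bound.**  If `DoorA34` holds then, for every support `d : Fin 4 → ℕ`, every coefficient
matrix `A : Fin 4 → Fin 4 → ℝ` and every `v₀,…,v₃ ∈ ℝ³`, the scalar polynomial `∑ᵢ C(Cᵢ²) ∏_{j≠i} Lⱼ`, `Lⱼ = ∑ₗ C(A j l) X^(d l)`,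
has at most `18` distinct positive roots.  (The converse needs genericity + closure and is NOT proved.) [folklore] -/
theorem card_posRoots_nodePoly_le_of_doorA34 (h : DoorA34) (d : Fin 4 → ℕ) (A : Fin 4 → Fin 4 → ℝ)
    (v : Fin 4 → Fin 3 → ℝ) :
    ((C ((v 1 0 * (v 2 1 * v 3 2 - v 3 1 * v 2 2) - v 2 0 * (v 1 1 * v 3 2 - v 3 1 * v 1 2)
          + v 3 0 * (v 1 1 * v 2 2 - v 2 1 * v 1 2)) ^ 2) *
          ((∑ l, C (A 1 l) * (X : ℝ[X]) ^ d l) * (∑ l, C (A 2 l) * (X : ℝ[X]) ^ d l) * (∑ l, C (A 3 l) * (X : ℝ[X]) ^ d l))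
      + C ((v 0 0 * (v 2 1 * v 3 2 - v 3 1 * v 2 2) - v 2 0 * (v 0 1 * v 3 2 - v 3 1 * v 0 2)
          + v 3 0 * (v 0 1 * v 2 2 - v 2 1 * v 0 2)) ^ 2) *
          ((∑ l, C (A 0 l) * (X : ℝ[X]) ^ d l) * (∑ l, C (A 2 l) * (X : ℝ[X]) ^ d l) * (∑ l, C (A 3 l) * (X : ℝ[X]) ^ d l))
      + C ((v 0 0 * (v 1 1 * v 3 2 - v 3 1 * v 1 2) - v 1 0 * (v 0 1 * v 3 2 - v 3 1 * v 0 2)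
          + v 3 0 * (v 0 1 * v 1 2 - v 1 1 * v 0 2)) ^ 2) *
          ((∑ l, C (A 0 l) * (X : ℝ[X]) ^ d l) * (∑ l, C (A 1 l) * (X : ℝ[X]) ^ d l) * (∑ l, C (A 3 l) * (X : ℝ[X]) ^ d l))
      + C ((v 0 0 * (v 1 1 * v 2 2 - v 2 1 * v 1 2) - v 1 0 * (v 0 1 * v 2 2 - v 2 1 * v 0 2)
          + v 2 0 * (v 0 1 * v 1 2 - v 1 1 * v 0 2)) ^ 2) *
          ((∑ l, C (A 0 l) * (X : ℝ[X]) ^ d l) * (∑ l, C (A 1 l) * (X : ℝ[X]) ^ d l) *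
            (∑ l, C (A 2 l) * (X : ℝ[X]) ^ d l))).roots.toFinset.filter (fun t => 0 < t)).card ≤ 18 := by
  have h' := h d (fun l => ∑ i, A i l • Matrix.vecMulVec (v i) (v i)) (fun l => isSymm_rankOneLetter A v l)
  rw [det_pencil_rankOneLetters_eq_nodePoly] at h'
  exact h'

/-- **Restricted to node-form nets, `DoorA34` IS the scalar statement**: «every node-form `(3,4)` pencil has `≤ 18` distinct
positive det-roots» ⟺ «every scalar polynomial `∑ᵢ C(Cᵢ²) ∏_{j≠i} Lⱼ` on a `4`-term support has `≤ 18` distinct positive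
roots». [folklore] -/
theorem doorA34_nodeForm_iff_scalar :
    (∀ (d : Fin 4 → ℕ) (A : Fin 4 → Fin 4 → ℝ) (v : Fin 4 → Fin 3 → ℝ),
      ((∑ l, (X : ℝ[X]) ^ d l • (∑ i, A i l • Matrix.vecMulVec (v i) (v i)).map C).det.roots.toFinset.filter
        (fun t => 0 < t)).card ≤ 18) ↔
    (∀ (d : Fin 4 → ℕ) (A : Fin 4 → Fin 4 → ℝ) (v : Fin 4 → Fin 3 → ℝ),
      ((C ((v 1 0 * (v 2 1 * v 3 2 - v 3 1 * v 2 2) - v 2 0 * (v 1 1 * v 3 2 - v 3 1 * v 1 2)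
          + v 3 0 * (v 1 1 * v 2 2 - v 2 1 * v 1 2)) ^ 2) *
          ((∑ l, C (A 1 l) * (X : ℝ[X]) ^ d l) * (∑ l, C (A 2 l) * (X : ℝ[X]) ^ d l) * (∑ l, C (A 3 l) * (X : ℝ[X]) ^ d l))
      + C ((v 0 0 * (v 2 1 * v 3 2 - v 3 1 * v 2 2) - v 2 0 * (v 0 1 * v 3 2 - v 3 1 * v 0 2)
          + v 3 0 * (v 0 1 * v 2 2 - v 2 1 * v 0 2)) ^ 2) *
          ((∑ l, C (A 0 l) * (X : ℝ[X]) ^ d l) * (∑ l, C (A 2 l) * (X : ℝ[X]) ^ d l) * (∑ l, C (A 3 l) * (X : ℝ[X]) ^ d l))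
      + C ((v 0 0 * (v 1 1 * v 3 2 - v 3 1 * v 1 2) - v 1 0 * (v 0 1 * v 3 2 - v 3 1 * v 0 2)
          + v 3 0 * (v 0 1 * v 1 2 - v 1 1 * v 0 2)) ^ 2) *
          ((∑ l, C (A 0 l) * (X : ℝ[X]) ^ d l) * (∑ l, C (A 1 l) * (X : ℝ[X]) ^ d l) * (∑ l, C (A 3 l) * (X : ℝ[X]) ^ d l))
      + C ((v 0 0 * (v 1 1 * v 2 2 - v 2 1 * v 1 2) - v 1 0 * (v 0 1 * v 2 2 - v 2 1 * v 0 2)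
          + v 2 0 * (v 0 1 * v 1 2 - v 1 1 * v 0 2)) ^ 2) *
          ((∑ l, C (A 0 l) * (X : ℝ[X]) ^ d l) * (∑ l, C (A 1 l) * (X : ℝ[X]) ^ d l) *
            (∑ l, C (A 2 l) * (X : ℝ[X]) ^ d l))).roots.toFinset.filter (fun t => 0 < t)).card ≤ 18) := by
  refine forall_congr' fun d => forall_congr' fun A => forall_congr' fun v => ?_
  rw [det_pencil_rankOneLetters_eq_nodePoly]

end Summit.ValiantsHypothesis.ValiantsHypothesis.Theorems.LacunarySymmetroidMatrixDescartes.Census
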